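import Literature.NumberTheory.Automorphic.Liu2021.AppendixC.EtaleBettiComparison
import Literature.AlgebraicGeometry.HodgeTheory.GysinFormalism
import HarnessLib

/-!
# `H¹_{B,τ'}(Alb_X, ℂ) ≅ H¹_{B,τ'}(X, ℂ)`, naturally in `X` (Liu 2021, Lemma 2.4 (1) with Def. 2.3): the
# comparison FAMILY as a hypothesis structure (cell hodgecm-mathlib, INVENTORY row III-0 = B3-01)

[Liu2021] = Yifeng Liu, *Fourier–Jacobi cycles and arithmetic relative trace formula*, Camb. J. Math. **9**
(2021) = arXiv:2102.11518; TeX line numbers `l. NNNN` refer to the held source `FJcycle.tex` as in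
`AppendixC/Glue.lean`.  Cell `hodgecm-mathlib` (D-0151), fan B-III, row III-0 «AlbaneseH1Comparison»
(B-plan2 2026-08-28T02:25:30Z; director RULING (P) 02:22:42Z; consumer = A-plan2's junction
`stub_bettiThetaModel_of_hyp413 : Hyp413 → (Albanese H¹ comparison) → StubBettiThetaModel`).
HC_CM is proved only modulo the 7 printed citations until rung 0 closes.

## What is printed

* **Def. 2.3** (l. 1202–1208): «Let `X` be a proper smooth scheme in `Sch_{/k}`. The abelian variety that
  corepresents the functor `Alb_X` is called the *Albanese variety* of `X`, denoted by `Alb_X`. The canonical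
  morphism `α_X : ∇X → Alb_X` is called the *Albanese morphism*. For a morphism `u : Y → X` of proper smooth
  schemes over `k`, we have the induced morphism `Alb_u : Alb_Y → Alb_X` by the universal property, which
  satisfies `Alb_u ∘ α_X = α_Y ∘ ∇u`.» — the tree's hypothesis structure `AppendixC.Albanese X`
  (`Glue.lean`: `nabla`, `Alb`, `α`, `desc`/`fac`/`uniq`) and, along the tower, the α-compatible pairs
  `(nablaTr f, Atr f)` of `AppendixC.Sec42Data` (`nablaTr_incl`, `α_Atr`) and of the Hecke translates
  (`HeckeTranslates.albTr`).
* **Lemma 2.4 (1)** (l. 1210–1213): «Suppose that `k` has characteristic zero. Then (1) for every homomorphism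
  `τ : k → ℂ`, we have a canonical isomorphism `H¹_{B,τ}(Alb_X, ℚ) ≃ H¹_{B,τ}(X, ℚ)`»; proof (l. 1220–1228):
  «we pick an element `x ∈ X(π₀(X ⊗_{k,τ} ℂ))`, which induces a morphism `(α_X)_x : X ⊗_{k,τ} ℂ → Alb_X ⊗_{k,τ} ℂ`
  […] By the property of complex Albanese varieties, the induced map `(α_X)_x^*` is an isomorphism; it is
  independent of the choice of `x` since translation acts trivially on `H¹_{B,τ}(Alb, ℚ)`.»

## What the tree already has (search-before-state)

* The POINTED, `ℚ`-coefficient edition of Lemma 2.4 (1) is the named fact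
  `Liu2021.albanese_bettiOne_pullback_bijective` (`Liu2021/Lemma24BettiAlbanese.lean`): for a choice of points
  `x` and the morphism `(α_X)_x`, `(α_X)_x^*` is bijective on `ℚ`-Betti `H¹`.
* «translation acts trivially on `H¹_{B}(Alb)`» is PROVED: `HodgeTheory.complexBetti_map_translation`
  (`HodgeTheory/AlgebraicClassesCupAbelianVariety.lean`).
* The consumer-side vocabulary: `bettiH1Along A τ' = H¹((A ×_{k,τ'} ℂ)(ℂ); ℂ)` and `bettiPullAlong τ' φ` for
  abelian varieties (`AppendixC/EtaleBettiComparison.lean`), `HodgeTheory.complexBetti`, `complexBetti.map`.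

## What this file adds (DEFINITIONS ONLY — no named fact, no instance; D-0026 net debt 0)

* `schemeBettiH1Along X τ'` — `H¹_{B,τ'}(X, ℂ) := H¹((X ×_{k,τ'} ℂ)(ℂ); ℂ)` for a `k`-scheme `X` (the `X`-side of the
  comparison), and `schemeBettiPullAlong τ' v = (v ×_{τ'} ℂ)^*` — spelled exactly as `bettiH1Along` /
  `bettiPullAlong` are (`complexBetti` of `Motives.baseChange k ℂ` for the algebra structure `τ'`).
* `AlbaneseH1ComparisonFamily k τ'` — a **hypothesis structure** (like `BettiPinning`): ONE `ℂ`-linear map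
  `cmp X a : H¹_{B,τ'}(Alb_X, ℂ) → H¹_{B,τ'}(X, ℂ)` for every `k`-scheme `X` and every Albanese datum `a` of `X`,
  BIJECTIVE when `X` is smooth (of some relative dimension) and projective over `k` — the predicates
  `SmoothOfRelativeDimension d X.hom`, `IsProjectiveOver X` of `CompactifiedSystem.smooth_X` / `projective_X` —
  and NATURAL for α-compatible pairs between smooth projective schemes: for `v : X ⟶ Y`, `nv : ∇X ⟶ ∇Y` over
  `v × v` and `φ : Alb_X ⟶ Alb_Y` with `α_X ≫ φ = nv ≫ α_Y` (Def. 2.3 «`Alb_u ∘ α = α ∘ ∇u`»),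
  `cmp X a ∘ φ^* = (v ×_{τ'} ℂ)^* ∘ cmp Y b`.  Quantifying `cmp` ONCE per `(k, τ')` with naturality (ref2
  02:26:17Z (i)) excludes junk families; restricting bijectivity/naturality to smooth projective `X`, `Y`
  keeps the ∀-closure true for every inhabitant of the hypothesis structure `Albanese X` (for such `X` all
  inhabitants are isomorphic over `α`, `Albanese.hom_ext`).
* `AlbaneseH1ComparisonFamily.cmpEquiv` — the comparison as a `LinearEquiv` on smooth projective `X`
  (from `bijective`), with its naturality restated.

The EXISTENCE `∀ k τ', Nonempty (AlbaneseH1ComparisonFamily k τ')` is Liu's Lemma 2.4 (1) (with the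
canonicity of Def. 2.3) and is to be DERIVED from `albanese_bettiOne_pullback_bijective` +
`complexBetti_map_translation` (coefficients `ℚ → ℂ`, choice of points on the geometrically irreducible
pieces, naturality from α-compatibility); it is deliberately NOT restated here as a second named fact.
A consumer takes `(cmp : AlbaneseH1ComparisonFamily E τ')` as a hypothesis.

## References

* [Liu2021] Y. Liu, Camb. J. Math. 9 (2021) = arXiv:2102.11518: Def. 2.1 (l. 1171–1184), Prop. 2.2 and
  Def. 2.3 (l. 1190–1208), Lemma 2.4 (1) with proof (l. 1210–1228); §4.2 (l. 2066–2081: `A_K = Alb_{X_K}`,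
  `H¹_{B,τ'}(A_∞, ℂ)`).
* [BirkenhakeLange2004] C. Birkenhake, H. Lange, *Complex Abelian Varieties*, 2nd ed., Springer 2004,
  §11.11 (the Albanese variety; `H¹(Alb(X), ℤ) ≅ H¹(X, ℤ)/torsion` for compact Kähler `X`) — provenance of
  «the property of complex Albanese varieties», cite-only.
-/

noncomputable section

open CategoryTheory AlgebraicGeometry MonoidalCategory
open scoped TensorProduct

namespace Literature.NumberTheory.Automorphic.Liu2021.AppendixC

open Literature.AlgebraicGeometry.Motives (SchemeOver AbelianVariety AlgPoints IsProjectiveOver)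
open Literature.AlgebraicGeometry.HodgeTheory (complexBetti)
open Literature.AlgebraicTopology.SingularHomology

universe u

section SchemeSide

variable {k : Type} [Field k]

/-- **`H¹_{B,τ'}(X, ℂ) := H¹((X ×_{k,τ'} ℂ)(ℂ); ℂ)`** — degree-one complex Betti cohomology of a `k`-scheme `X` along
`τ' : k → ℂ`: the tree's `HodgeTheory.complexBetti` of the base change `(Motives.baseChange k ℂ).obj X` for the
`k`-algebra structure `τ'` on `ℂ` (`algebraAlong`); for an abelian variety `A`, `schemeBettiH1Along A.X τ'` is
`bettiH1Along A τ'` by `rfl`. [cite: Liu2021, Lemma 2.4 (1) (FJcycle.tex l. 1210–1213: «H¹_{B,τ}(X, ℚ)»)] -/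
abbrev schemeBettiH1Along (X : SchemeOver k) (τ' : k →+* ℂ) : Type :=
  letI : Algebra k ℂ := algebraAlong k τ'
  ↥(complexBetti ((Literature.AlgebraicGeometry.Motives.baseChange k ℂ).obj X) 1)

/-- `H¹_{B,τ'}` of the underlying scheme of an abelian variety is `bettiH1Along` (by `rfl`).
[cite: Liu2021, §4.2 (FJcycle.tex l. 2079)] -/
theorem schemeBettiH1Along_X (A : AbelianVariety k) (τ' : k →+* ℂ) :
    schemeBettiH1Along A.X τ' = bettiH1Along A τ' := rfl

/-- **Pull-back `(v ×_{τ'} ℂ)^* : H¹_{B,τ'}(Y, ℂ) → H¹_{B,τ'}(X, ℂ)`** along a `k`-morphism `v : X ⟶ Y`: `complexBetti.map`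
of the base-changed morphism (the same spelling as `bettiPullAlong`). [cite: Liu2021, Def. 2.3 (FJcycle.tex l. 1206–1208: «for a morphism u : Y → X … ∇u»)] -/
def schemeBettiPullAlong (τ' : k →+* ℂ) {X Y : SchemeOver k} (v : X ⟶ Y) :
    schemeBettiH1Along Y τ' →ₗ[ℂ] schemeBettiH1Along X τ' :=
  letI : Algebra k ℂ := algebraAlong k τ'
  (complexBetti.map ((Literature.AlgebraicGeometry.Motives.baseChange k ℂ).map v) 1).hom

/-- Unfolding of `schemeBettiPullAlong`. [cite: Liu2021, Def. 2.3 (FJcycle.tex l. 1206–1208)] -/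
theorem schemeBettiPullAlong_def (τ' : k →+* ℂ) {X Y : SchemeOver k} (v : X ⟶ Y) :
    schemeBettiPullAlong τ' v =
      letI : Algebra k ℂ := algebraAlong k τ'
      (complexBetti.map ((Literature.AlgebraicGeometry.Motives.baseChange k ℂ).map v) 1).hom :=
  rfl

/-- `(𝟙_X ×_{τ'} ℂ)^* = id`. [cite: Liu2021, Def. 2.3 (FJcycle.tex l. 1206–1208)] -/
theorem schemeBettiPullAlong_id (τ' : k →+* ℂ) (X : SchemeOver k) :
    schemeBettiPullAlong τ' (𝟙 X) = LinearMap.id := by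
  letI : Algebra k ℂ := algebraAlong k τ'
  rw [schemeBettiPullAlong_def, CategoryTheory.Functor.map_id, complexBetti.map_id]
  rfl

/-- `((v ≫ w) ×_{τ'} ℂ)^* = (v ×_{τ'} ℂ)^* ∘ (w ×_{τ'} ℂ)^*` (contravariant functoriality of `H¹_{B,τ'}`).
[cite: Liu2021, Def. 2.3 (FJcycle.tex l. 1206–1208)] -/
theorem schemeBettiPullAlong_comp (τ' : k →+* ℂ) {X Y Z : SchemeOver k} (v : X ⟶ Y) (w : Y ⟶ Z) :
    schemeBettiPullAlong τ' (v ≫ w) = schemeBettiPullAlong τ' v ∘ₗ schemeBettiPullAlong τ' w := by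
  letI : Algebra k ℂ := algebraAlong k τ'
  rw [schemeBettiPullAlong_def, schemeBettiPullAlong_def, schemeBettiPullAlong_def, CategoryTheory.Functor.map_comp,
    complexBetti.map_comp]
  rfl

end SchemeSide

/-! ### The comparison family (hypothesis structure) -/

/-- **The Albanese comparison family in degree one along `τ'`** (Liu 2021, Lemma 2.4 (1) with the canonicity of
Def. 2.3), a HYPOTHESIS STRUCTURE: for every `k`-scheme `X` and every Albanese datum `a = (∇X, Alb_X, α_X)` of `X`
a `ℂ`-linear map `cmp X a : H¹_{B,τ'}(Alb_X, ℂ) → H¹_{B,τ'}(X, ℂ)` («we have a canonical isomorphism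
`H¹_{B,τ}(Alb_X, ℚ) ≃ H¹_{B,τ}(X, ℚ)`», the map `(α_X)_x^*`, «independent of the choice of `x`»), which is
* `bijective` when `X` is smooth and projective over `k` («Let X be a proper smooth scheme»; the predicates are
  those of `CompactifiedSystem.smooth_X` / `projective_X`);
* `natural` for α-compatible pairs between smooth projective schemes: for `v : X ⟶ Y`, `nv : ∇X ⟶ ∇Y` with
  `nv ≫ incl_Y = incl_X ≫ (v × v)` and `φ : Alb_X ⟶ Alb_Y` with `α_X ≫ φ = nv ≫ α_Y` (Def. 2.3: «the induced
  morphism `Alb_u` […] satisfies `Alb_u ∘ α = α ∘ ∇u`»), `cmp X a (φ^* y) = (v ×_{τ'} ℂ)^* (cmp Y b y)`.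
Nothing is asserted: existence for number fields `k` is Lemma 2.4 (1), to be derived from the tree's pointed
edition `Liu2021.albanese_bettiOne_pullback_bijective` and `HodgeTheory.complexBetti_map_translation`; a
consumer takes `(cmp : AlbaneseH1ComparisonFamily k τ')`.
[cite: Liu2021, Lemma 2.4 (1) (FJcycle.tex l. 1210–1213) with proof (l. 1220–1228); Def. 2.3 (l. 1202–1208)]
[cite: BirkenhakeLange2004, §11.11 (the Albanese torus of a compact Kähler manifold; H¹ comparison)] -/
structure AlbaneseH1ComparisonFamily (k : Type) [Field k] (τ' : k →+* ℂ) : Type 2 where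
  /-- the comparison map `H¹_{B,τ'}(Alb_X, ℂ) → H¹_{B,τ'}(X, ℂ)` at `(X, a)` -/
  cmp : ∀ (X : SchemeOver k) (a : Albanese X), bettiH1Along a.Alb τ' →ₗ[ℂ] schemeBettiH1Along X τ'
  /-- on a smooth projective `X` the comparison map is a bijection -/
  bijective : ∀ (X : SchemeOver k) (a : Albanese X) (d : ℕ),
    SmoothOfRelativeDimension d X.hom → IsProjectiveOver X → Function.Bijective (cmp X a)
  /-- naturality for α-compatible pairs `(v, nv, φ)` between smooth projective `X`, `Y`:
  `cmp_X (φ^* y) = (v ×_{τ'} ℂ)^* (cmp_Y y)` -/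
  natural : ∀ {X Y : SchemeOver k} (a : Albanese X) (b : Albanese Y) (dX dY : ℕ),
    SmoothOfRelativeDimension dX X.hom → IsProjectiveOver X →
    SmoothOfRelativeDimension dY Y.hom → IsProjectiveOver Y →
    ∀ (v : X ⟶ Y) (nv : a.nabla.N ⟶ b.nabla.N) (φ : a.Alb ⟶ b.Alb),
      nv ≫ b.nabla.incl = a.nabla.incl ≫ (v ⊗ₘ v) →
      a.α ≫ φ.hom.hom.hom = nv ≫ b.α →
      ∀ y : bettiH1Along b.Alb τ',
        cmp X a (bettiPullAlong τ' φ y) = schemeBettiPullAlong τ' v (cmp Y b y)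

namespace AlbaneseH1ComparisonFamily

variable {k : Type} [Field k] {τ' : k →+* ℂ} (c : AlbaneseH1ComparisonFamily k τ')

/-- **`H¹_{B,τ'}(Alb_X, ℂ) ≃ H¹_{B,τ'}(X, ℂ)` as a linear equivalence** on a smooth projective `X` (field `bijective`).
[cite: Liu2021, Lemma 2.4 (1) (FJcycle.tex l. 1210–1213)] -/
def cmpEquiv (X : SchemeOver k) (a : Albanese X) {d : ℕ} (hs : SmoothOfRelativeDimension d X.hom)
    (hp : IsProjectiveOver X) : bettiH1Along a.Alb τ' ≃ₗ[ℂ] schemeBettiH1Along X τ' :=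
  LinearEquiv.ofBijective (c.cmp X a) (c.bijective X a d hs hp)

/-- `cmpEquiv` is `cmp` as a function. [cite: Liu2021, Lemma 2.4 (1) (FJcycle.tex l. 1210–1213)] -/
@[simp] theorem cmpEquiv_apply (X : SchemeOver k) (a : Albanese X) {d : ℕ} (hs : SmoothOfRelativeDimension d X.hom)
    (hp : IsProjectiveOver X) (y : bettiH1Along a.Alb τ') : c.cmpEquiv X a hs hp y = c.cmp X a y := rfl

/-- The comparison map on a smooth projective `X` is injective. [cite: Liu2021, Lemma 2.4 (1) (FJcycle.tex l. 1210–1213)] -/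
theorem cmp_injective (X : SchemeOver k) (a : Albanese X) {d : ℕ} (hs : SmoothOfRelativeDimension d X.hom)
    (hp : IsProjectiveOver X) : Function.Injective (c.cmp X a) :=
  (c.bijective X a d hs hp).1

/-- The comparison map on a smooth projective `X` is surjective. [cite: Liu2021, Lemma 2.4 (1) (FJcycle.tex l. 1210–1213)] -/
theorem cmp_surjective (X : SchemeOver k) (a : Albanese X) {d : ℕ} (hs : SmoothOfRelativeDimension d X.hom)
    (hp : IsProjectiveOver X) : Function.Surjective (c.cmp X a) :=
  (c.bijective X a d hs hp).2

/-- **Naturality as an equation of linear maps**: `cmp_X ∘ φ^* = (v ×_{τ'} ℂ)^* ∘ cmp_Y` for an α-compatible pair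
between smooth projective schemes. [cite: Liu2021, Def. 2.3 (FJcycle.tex l. 1206–1208) and Lemma 2.4 (1)] -/
theorem cmp_comp_bettiPullAlong {X Y : SchemeOver k} (a : Albanese X) (b : Albanese Y) {dX dY : ℕ}
    (hsX : SmoothOfRelativeDimension dX X.hom) (hpX : IsProjectiveOver X)
    (hsY : SmoothOfRelativeDimension dY Y.hom) (hpY : IsProjectiveOver Y)
    (v : X ⟶ Y) (nv : a.nabla.N ⟶ b.nabla.N) (φ : a.Alb ⟶ b.Alb)
    (hnv : nv ≫ b.nabla.incl = a.nabla.incl ≫ (v ⊗ₘ v)) (hφ : a.α ≫ φ.hom.hom.hom = nv ≫ b.α) :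
    c.cmp X a ∘ₗ bettiPullAlong τ' φ = schemeBettiPullAlong τ' v ∘ₗ c.cmp Y b :=
  LinearMap.ext fun y => c.natural a b dX dY hsX hpX hsY hpY v nv φ hnv hφ y

/-- **The inverse direction of naturality**: `(cmp_X)⁻¹ ∘ (v ×_{τ'} ℂ)^* = φ^* ∘ (cmp_Y)⁻¹` on smooth projective
`X`, `Y` — the form in which a consumer transports an `X`-side pull-back law (e.g. the Hecke law of a Betti
tower of `X_K`'s) to the Albanese side (`BettiPinning.b_hecke`). [cite: Liu2021, §4.2 (FJcycle.tex l. 2074–2081) with Lemma 2.4 (1)] -/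
theorem cmpEquiv_symm_schemeBettiPullAlong {X Y : SchemeOver k} (a : Albanese X) (b : Albanese Y) {dX dY : ℕ}
    (hsX : SmoothOfRelativeDimension dX X.hom) (hpX : IsProjectiveOver X)
    (hsY : SmoothOfRelativeDimension dY Y.hom) (hpY : IsProjectiveOver Y)
    (v : X ⟶ Y) (nv : a.nabla.N ⟶ b.nabla.N) (φ : a.Alb ⟶ b.Alb)
    (hnv : nv ≫ b.nabla.incl = a.nabla.incl ≫ (v ⊗ₘ v)) (hφ : a.α ≫ φ.hom.hom.hom = nv ≫ b.α)
    (z : schemeBettiH1Along Y τ') :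
    (c.cmpEquiv X a hsX hpX).symm (schemeBettiPullAlong τ' v z) =
      bettiPullAlong τ' φ ((c.cmpEquiv Y b hsY hpY).symm z) := by
  apply (c.cmpEquiv X a hsX hpX).injective
  rw [LinearEquiv.apply_symm_apply, cmpEquiv_apply,
    c.natural a b dX dY hsX hpX hsY hpY v nv φ hnv hφ, ← cmpEquiv_apply c Y b hsY hpY,
    LinearEquiv.apply_symm_apply]

end AlbaneseH1ComparisonFamily

end Literature.NumberTheory.Automorphic.Liu2021.AppendixC

end
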